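import Literature.Probability.RandomPlanarGeometry.YangBaxterSAWExcursion
import Literature.Probability.RandomPlanarGeometry.YangBaxterSAWHexBridges
import Literature.Probability.RandomPlanarGeometry.YangBaxterSAWTwoPointProofs
import HarnessLib

/-!
# Glazman–Manolescu, Theorems 1 and 2 for the Yang–Baxter self-avoiding walk — discharged

Topic `Literature/Probability/RandomPlanarGeometry`; proof file (no definitions, no named facts)
for the two named facts of `YangBaxterSAW.lean`

* `GlazmanManolescu2019_thm1` — A. Glazman, I. Manolescu, *Self-avoiding walk on `ℤ²` with
  Yang–Baxter weights: universality of critical fugacity and 2-point function*, Ann. Inst. Henri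
  Poincaré Probab. Stat. 56 (2020) = arXiv:1708.00395, **Theorem 1**: for angles
  `θ_k ∈ [π/3, 2π/3]` the boundary two-point function of the right half-plane does not depend on
  `Θ`, `G_Θ(a, b) = G_{π/3}(a, b)`;
* `GlazmanManolescu2019_thm2` — loc. cit., **Theorem 2**: `B_{T,Θ} → 0` as `T → ∞`.

The printed proof (§4: "Theorems 1 and 2 follow from Proposition 1.1, Corollary 2.3 and
Proposition 4.2") is in the tree as the assemblies `GlazmanManolescu2019_thm1_of_prop11_prop42`,
`GlazmanManolescu2019_thm2_of_prop11_prop42` (`YangBaxterSAWExcursion.lean`, with Lemma 2.1,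
the boundary winding and Corollary 2.3 already discharged there), over the two named facts
`GlazmanManolescu2019_prop11_limit` ("`B_T(π/3) → 0`", Proposition 1.1) and
`GlazmanManolescu2019_prop42` (column exchange, Proposition 4.2). Both have since been
discharged — `GlazmanManolescu2019_prop11_limit_holds` (`YangBaxterSAWHexBridges.lean`, via the
hexagonal-lattice bridge decay of `HexSAWBridgeDecay.lean`) and `GlazmanManolescu2019_prop42_holds`
(`YangBaxterSAWTwoPointProofs.lean`, the Yang–Baxter column transposition) — so Theorems 1 and 2
hold outright. This file only composes (librarian sweep `libsplit-39`, fact decomposition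
2026-08-16: the fact was found provable as filed, hence discharged rather than split). Theorem 3
(`GlazmanManolescu2019_thm3`, `y_c = 1 + √2`) is not treated here.

## References

* A. Glazman, I. Manolescu, Ann. Inst. Henri Poincaré Probab. Stat. 56 (2020) 2281–2300,
  arXiv:1708.00395: Theorems 1–2, Proposition 1.1, Corollary 2.3, Proposition 4.2, §4.
  [GlazmanManolescu2019]
-/

noncomputable section

namespace Literature.Probability.RandomPlanarGeometry.SAW.YangBaxter

/-- **Glazman–Manolescu, Theorem 1, discharged**: "Let `Θ = {θ_k}`, `θ_k ∈ [π/3, 2π/3]` for all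
`k`. Then `G_Θ(a, b) = G_{π/3}(a, b)` for any two points `a`, `b` on the boundary of the right
half-plane" — the named fact `GlazmanManolescu2019_thm1` holds, by
`GlazmanManolescu2019_thm1_of_prop11_prop42` applied to `GlazmanManolescu2019_prop11_limit_holds`
and `GlazmanManolescu2019_prop42_holds`. [cite: GlazmanManolescu2019, Theorem 1 (proof, §4)] -/
theorem GlazmanManolescu2019_thm1_holds : GlazmanManolescu2019_thm1 :=
  GlazmanManolescu2019_thm1_of_prop11_prop42 GlazmanManolescu2019_prop11_limit_holds
    GlazmanManolescu2019_prop42_holds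

/-- **Glazman–Manolescu, Theorem 2, discharged**: "Let `Θ = {θ_k}`, `θ_k ∈ [π/3, 2π/3]` for all
`k`. Then `B_{T,Θ} → 0` as `T → ∞`" — the named fact `GlazmanManolescu2019_thm2` holds, by
`GlazmanManolescu2019_thm2_of_prop11_prop42` applied to the same two discharged inputs.
[cite: GlazmanManolescu2019, Theorem 2 (proof, §4)] -/
theorem GlazmanManolescu2019_thm2_holds : GlazmanManolescu2019_thm2 :=
  GlazmanManolescu2019_thm2_of_prop11_prop42 GlazmanManolescu2019_prop11_limit_holds
    GlazmanManolescu2019_prop42_holds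

end Literature.Probability.RandomPlanarGeometry.SAW.YangBaxter

end
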